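import Literature.NumberTheory.EllipticCurves.CyclotomicLayerRhoTatePairingPk
import Literature.NumberTheory.EllipticCurves.SupersingularModPDecompositionImageProofs
import Summits.BirchSwinnertonDyer.BirchSwinnertonDyer.Theorems.ResidualThetaTransportAtTwoResidualSignedLambdaLowerCMAtTwoLayerPairingScalar
import Summits.BirchSwinnertonDyer.BirchSwinnertonDyer.Theorems.ResidualThetaTransportAtTwoThetaTransportIntegralSchurAtTwo
import HarnessLib

/-!
# Sketch (stub-ideation k3·g20, technique «decomposition») — Σ_bal AT TWO, decomposed with PROVED glue:
# the scalar `a ∈ 𝒪` crosses the `ρ`-coefficient layer Tate pairing `rhoLayerPairingPk` as an INTEGER MATRIX on the point tuple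

Crux (R≥)ᵖ `ResidualThetaCountLowerPureAtTwo` (stmt-BirchSwinnertonDyer-26074), stub `stub_cmLambdaLower` = RSL_g
`ResidualSignedLambdaLowerCMAtTwo` (stmt-BirchSwinnertonDyer-22608), route `ResidualThetaTransportAtTwo` (RTT). Seat
`planner-sidea-stub_cmLambdaLower-3` g20; THEOREMS ONLY (no `def`, no instance, no notation, no named fact, no `sorry`); nothing is
proposed to `Theorems/`; BSD is NOT proved by any of this; 22608 / 26074 stay OPEN.

THE ATOM. k3-g19 isolated the one open arithmetic input of the `(i)`-half adapter on the S₀/points side («Σ_bal», STUB-PLAN S109 H9):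
`⟨a • y, Q⟩_{n,2^k} = ⟨y, N_kᵀ Q⟩_{n,2^k}` for the residues `rhoLayerPairingPk` (consumed verbatim by its `hPA_of_levelwise`). Since then
w2 g20 landed `reduceH1CofreePkTorsion_smul` (`red(a•y) = (a·)_* red y`), `layerPairingOf_map_adjoint` and
`OnePairPins.ePk_cofreeTorsionScalar_comm` (p706992 / p707215 / p707702): the scalar now sits on the LOCAL COEFFICIENT CLASS as
`(a·)_* = cohomologyMap (cofreeTorsionLocalScalar a)`. What was still missing is the Θ-TRANSPORT of that scalar onto the Kummer tuple.

DECOMPOSITION (each piece a theorem here; the glue (δ) is proved, not posited):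
* (γ₀) point level — `(a·) ∘ Θ⁻¹(·δ_i) = Σ_j Θ⁻¹((N i j • ·) δ_j)` on `E[2^k]` from the matrix clause
  `Θ(a • Θ⁻¹ P)_j = Σ_i N i j • P_i` (`thetaSingle_cofreeTorsionLocalScalar_of_matrix`);
* (γ) class level — `(a·)_* (thetaSingle i)_* c = Σ_j (thetaSingle j)_* (N i j • c)` and
  `(a·)_* thetaLayerKummer Q = thetaLayerKummer (Nᵀ Q)` (`cohomologyMap_cofreeTorsionLocalScalar_thetaSingleH1 / _thetaLayerKummer`) —
  the «one new map-naturality lemma» k4-g20 PLAN 2 (3) flagged as the real risk, done on inhomogeneous cocycles;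
* (δ) GLUE — Σ_bal for ANY self-dual datum `ePk` balanced for `a·` (`rhoLayerPairingPk_smul_balance`, `p = 2`, `d = 2`);
* (ε) the matrix clause at the pins from INTEGRAL SCHUR (`decomp_equivariant_addMonoidHom_pi_primary_eq_sum_nsmul`, Serre 1972 Prop. 12
  DISCHARGED by `serre1972_supersingular_decompositionSubgroup_image_holds`) — `exists_matrix_theta_smul`; uniqueness of `N_k (mod 2^k)`
  (a point of exact order `2^k`, `exists_geomPrimaryTorsion_addOrderOf_eq`), restriction `k+1 → k`, and the `2`-ADIC PACKAGING of the `N_k`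
  into ONE `N ∈ M_r(ℤ₂)` by `PadicInt.ofIntSeq` (`exists_padicInt_matrix_theta_smul`);
* (Σ_bal@π) for every one-pair pin bundle `π` (`rhoLayerPairingPk_smul_balance_pins`: VERBATIM the binders `N`, `Nk`, `hNk`, `hbal` of k3-g19
  `SideaK3G19.hPA_of_levelwise`) and the residue form on THE pairing `π.pair` (`toZModPow_pair_smul`).
What is NOT here (next owners): feeding `hPA_of_levelwise` (k3-g19 file B, its theorem) to get the exact `ℤ₂` identity; the ring-hom packaging
`a ↦ N(a)` of k4-g20 `H9locValues` (multiplicativity mod `2^k` is the same uniqueness lemma; not typed here); H-BKρ; H11 (print).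

References: [Kato2004Asterisque] §13.8 (pp. 228–229), §14.9 (p. 239); [Kobayashi2003] (8.23) (p. 18); [SerreInventiones1972] §1.11 Prop. 12;
[SerreGaloisCohomology1997] I §2.2; [Greenberg1989] §1 p. 98; [PerrinRiou1994Invent] §3.6.1.
-/

set_option autoImplicit false
-- the Cruxes namespace of this sub repeats the summit name by design (D-0017 nested layout)
set_option linter.dupNamespace false

noncomputable section

open scoped Classical

namespace Summit.BirchSwinnertonDyer.BirchSwinnertonDyer.Cruxes.ResidualThetaCountLowerPureAtTwo.SideaK3G20

open CategoryTheory Field NumberField IsDedekindDomain _root_.WeierstrassCurve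
  Literature.NumberTheory.EllipticCurves Literature.NumberTheory.GaloisRepresentations
  Literature.NumberTheory.EllipticCurves.GreenbergSelmer Literature.NumberTheory.EllipticCurves.CyclotomicLayer
  Literature.NumberTheory.EllipticCurves.Kobayashi2003 Literature.NumberTheory.EllipticCurves.Kato2004
  Literature.NumberTheory.EllipticCurves.Rank1Residual
  Summit.BirchSwinnertonDyer.BirchSwinnertonDyer.Theorems.ThetaTransport
  Summit.BirchSwinnertonDyer.BirchSwinnertonDyer.Theorems.OnePair

/-! ## §1 (γ) The Θ-transport of the scalar: class level from point level (any `p`, `d`, `r`) -/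

section Transport

variable {p : ℕ} [Fact p.Prime] (S : Set (PadicAlgCl p)) {d : ℕ} (ρ : FramedGaloisRep ℚ ↥(padicCoeffIntegers S) d) (k : ℕ)
  (W : WeierstrassCurve ℚ) {r : ℕ} (Θ : Cofree ρ ↥(padicCoeffField S) ≃+ (Fin r → ↥(W.geomPrimaryTorsion p)))
  (κ : ZpExtension ℚ p) (v : HeightOneSpectrum (𝓞 ℚ))
  (hΘ : ∀ (δ : absoluteGaloisGroup (v.adicCompletion ℚ)) (m : Cofree ρ ↥(padicCoeffField S)) (i : Fin r),
    Θ (resGalOfEmb (closureEmb (K := ℚ) (v.adicCompletion ℚ)) δ • m) i =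
      resGalOfEmb (closureEmb (K := ℚ) (v.adicCompletion ℚ)) δ • Θ m i)
  (a : ↥(padicCoeffIntegers S)) (Nk : Fin r → Fin r → ℕ)

/-- **(γ₀) from the matrix clause.** If `Θ(a • Θ⁻¹ P)_j = Σ_i N i j • P_i` on `E[p^k]^r`, then on each coordinate
`(a·) (Θ⁻¹(P δ_i)) = Σ_j Θ⁻¹((N i j • P) δ_j)` in `A_ρ[p^k]`. [cite: Greenberg1989, §1 p. 98] -/
theorem thetaSingle_cofreeTorsionLocalScalar_of_matrix
    (hN : ∀ (P : Fin r → ↥(geomTorsion W ((p ^ k : ℕ) : ℤ))) (j : Fin r),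
      Θ (a • Θ.symm (fun i ↦ AddSubgroup.inclusion (geomTorsion_natCast_pow_le_geomPrimaryTorsion p k W) (P i))) j =
        ∑ i, Nk i j • AddSubgroup.inclusion (geomTorsion_natCast_pow_le_geomPrimaryTorsion p k W) (P i))
    (i : Fin r) (P : ↥(geomTorsion W ((p ^ k : ℕ) : ℤ))) :
    (cofreeTorsionLocalScalar S ρ ((p ^ k : ℕ) : ℤ) a v).hom (thetaSingle ρ p k W Θ i P) =
      ∑ j, thetaSingle ρ p k W Θ j (Nk i j • P) := by
  refine Subtype.ext ?_
  rw [coe_cofreeTorsionLocalScalar_apply, coe_thetaSingle, AddSubmonoidClass.coe_finsetSum]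
  simp_rw [coe_thetaSingle, ← map_sum]
  rw [Finset.univ_sum_single]
  apply Θ.injective
  rw [AddEquiv.apply_symm_apply]
  funext j
  have hsingle : (Pi.single i (AddSubgroup.inclusion (geomTorsion_natCast_pow_le_geomPrimaryTorsion p k W) P) :
      Fin r → ↥(W.geomPrimaryTorsion p)) =
      fun l ↦ AddSubgroup.inclusion (geomTorsion_natCast_pow_le_geomPrimaryTorsion p k W)
        ((Pi.single i P : Fin r → ↥(geomTorsion W ((p ^ k : ℕ) : ℤ))) l) := by
    funext l
    by_cases hl : l = i
    · subst hl; rw [Pi.single_eq_same, Pi.single_eq_same]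
    · rw [Pi.single_eq_of_ne hl, Pi.single_eq_of_ne hl, map_zero]
  rw [hsingle, hN (Pi.single i P) j, map_nsmul]
  rw [Finset.sum_eq_single i (fun l _ hl ↦ by rw [Pi.single_eq_of_ne hl, map_zero, smul_zero])
    (fun h ↦ (h (Finset.mem_univ i)).elim), Pi.single_eq_same]

set_option maxHeartbeats 800000 in
/-- **(γ) on one coordinate: `(a·)_* ∘ (thetaSingle i)_* = Σ_j (thetaSingle j)_* ∘ (N i j • ·)` on `H¹(U_n, E[p^k]|)`.**
Pure `H¹`-naturality on inhomogeneous cocycles (`[ψ] ↦ [a • Θ⁻¹(ψ δ_i)] = Σ_j [Θ⁻¹((N i j • ψ) δ_j)]`) from the point identity (γ₀).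
[cite: SerreGaloisCohomology1997, I §2.2] [cite: Greenberg1989, §1 p. 98] -/
theorem cohomologyMap_cofreeTorsionLocalScalar_thetaSingleH1
    (hγ : ∀ (i : Fin r) (P : ↥(geomTorsion W ((p ^ k : ℕ) : ℤ))),
      (cofreeTorsionLocalScalar S ρ ((p ^ k : ℕ) : ℤ) a v).hom (thetaSingle ρ p k W Θ i P) = ∑ j, thetaSingle ρ p k W Θ j (Nk i j • P))
    (i : Fin r) (n : ℕ) (c : continuousCohomology 1 (subgroupRep (torsionLocalRep W (p ^ k) v) (layerGroup κ v n))) :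
    cohomologyMap (subgroupRepMap (cofreeTorsionLocalScalar S ρ ((p ^ k : ℕ) : ℤ) a v) (layerGroup κ v n)) 1
        (thetaSingleH1 S ρ k W Θ κ v hΘ i n c) =
      ∑ j, thetaSingleH1 S ρ k W Θ κ v hΘ j n (Nk i j • c) := by
  obtain ⟨ψ, rfl⟩ := oneCocycleClass_surjective _ c
  have hR : ∀ j, thetaSingleH1 S ρ k W Θ κ v hΘ j n (Nk i j • oneCocycleClass _ ψ) =
      oneCocycleClassₗ _ (Nk i j • contOneCocycles.pushAddHom (thetaSingle ρ p k W Θ j) continuous_of_discreteTopology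
        (thetaSingle_subgroupRep S ρ k W Θ κ v hΘ j n) ψ) := fun j ↦ by
    rw [map_nsmul (thetaSingleH1 S ρ k W Θ κ v hΘ j n), thetaSingleH1_oneCocycleClass,
      map_nsmul (oneCocycleClassₗ _), oneCocycleClassₗ_apply]
  rw [thetaSingleH1_oneCocycleClass, cohomologyMap_oneCocycleClass, Fintype.sum_congr _ _ hR,
    ← map_sum (oneCocycleClassₗ _), oneCocycleClassₗ_apply]
  refine congrArg _ (Subtype.ext (ContinuousMap.ext fun g ↦ ?_))
  refine (hγ i (ψ.1 g)).trans ?_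
  rw [Submodule.coe_sum, ContinuousMap.coe_sum, Finset.sum_apply]
  refine Finset.sum_congr rfl fun j _ ↦ ?_
  rw [Submodule.coe_smul_of_tower, ContinuousMap.coe_smul, Pi.smul_apply, contOneCocycles.pushAddHom_apply, map_nsmul]

variable [W.IsElliptic]

/-- **(γ) on tuples: `(a·)_* thetaLayerKummer Q = thetaLayerKummer (Nᵀ Q)`**, `(Nᵀ Q)_j = Σ_i N i j • Q_i` — the scalar crosses the Θ-transported
Kummer map as an integer matrix on the layer points ((γ) per coordinate, additivity of `κ_{U_n}` and of `(thetaSingle j)_*`, `Finset.sum_comm`).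
[cite: Kobayashi2003, (8.23) (p. 18)] [cite: Greenberg1989, §1 p. 98] -/
theorem cohomologyMap_cofreeTorsionLocalScalar_thetaLayerKummer
    (hγ : ∀ (i : Fin r) (P : ↥(geomTorsion W ((p ^ k : ℕ) : ℤ))),
      (cofreeTorsionLocalScalar S ρ ((p ^ k : ℕ) : ℤ) a v).hom (thetaSingle ρ p k W Θ i P) = ∑ j, thetaSingle ρ p k W Θ j (Nk i j • P))
    (n : ℕ) (Q : Fin r → ↥(localLayerPointsOfEmb κ (closureEmb (K := ℚ) (v.adicCompletion ℚ)) W n)) :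
    cohomologyMap (subgroupRepMap (cofreeTorsionLocalScalar S ρ ((p ^ k : ℕ) : ℤ) a v) (layerGroup κ v n)) 1
        (thetaLayerKummer S ρ k W Θ κ v hΘ n Q) =
      thetaLayerKummer S ρ k W Θ κ v hΘ n (fun j ↦ ∑ i, Nk i j • Q i) := by
  have hadd : ∀ x : Fin r → continuousCohomology 1 (subgroupRep (cofreeTorsionLocalRep S ρ ((p ^ k : ℕ) : ℤ) v) (layerGroup κ v n)),
      cohomologyMap (subgroupRepMap (cofreeTorsionLocalScalar S ρ ((p ^ k : ℕ) : ℤ) a v) (layerGroup κ v n)) 1 (∑ i, x i) =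
        ∑ i, cohomologyMap (subgroupRepMap (cofreeTorsionLocalScalar S ρ ((p ^ k : ℕ) : ℤ) a v) (layerGroup κ v n)) 1 (x i) :=
    fun x ↦ map_sum (cohomologyMap _ 1).hom x _
  rw [thetaLayerKummer_apply, thetaLayerKummer_apply, hadd]
  simp_rw [cohomologyMap_cofreeTorsionLocalScalar_thetaSingleH1 S ρ k W Θ κ v hΘ a Nk hγ, map_sum, map_nsmul]
  exact Finset.sum_comm

end Transport

/-! ## §2 (δ) THE GLUE — Σ_bal for a balanced self-dual datum (`p = 2`, `d = 2`, any `r`) -/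

section Glue

variable (S : Set (PadicAlgCl 2)) (ρ : FramedGaloisRep ℚ ↥(padicCoeffIntegers S) 2) (W : WeierstrassCurve ℚ) [W.IsElliptic] {r : ℕ}
  (ePk : ∀ k : ℕ, ↥(AddSubgroup.torsionBy (Cofree ρ ↥(padicCoeffField S)) ((2 ^ k : ℕ) : ℤ)) →
    ↥(AddSubgroup.torsionBy (Cofree ρ ↥(padicCoeffField S)) ((2 ^ k : ℕ) : ℤ)) → AlgebraicClosure ℚ)
  (hμPk : ∀ k a b, ePk k a b ^ (2 ^ k) = 1)
  (hadd₁Pk : ∀ k a₁ a₂ b, ePk k (a₁ + a₂) b = ePk k a₁ b * ePk k a₂ b)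
  (hadd₂Pk : ∀ k a b₁ b₂, ePk k a (b₁ + b₂) = ePk k a b₁ * ePk k a b₂)
  (hgalPk : ∀ k (σ : absoluteGaloisGroup ℚ) (a b : ↥(AddSubgroup.torsionBy (Cofree ρ ↥(padicCoeffField S)) ((2 ^ k : ℕ) : ℤ))),
    σ • ePk k a b = ePk k (cofreeTorsionGaloisModule S ρ _ σ a) (cofreeTorsionGaloisModule S ρ _ σ b))
  (Θ : Cofree ρ ↥(padicCoeffField S) ≃+ (Fin r → ↥(W.geomPrimaryTorsion 2))) (κ : ZpExtension ℚ 2)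
  (v : HeightOneSpectrum (𝓞 ℚ))
  (hΘ : ∀ (δ : absoluteGaloisGroup (v.adicCompletion ℚ)) (m : Cofree ρ ↥(padicCoeffField S)) (i : Fin r),
    Θ (resGalOfEmb (closureEmb (K := ℚ) (v.adicCompletion ℚ)) δ • m) i =
      resGalOfEmb (closureEmb (K := ℚ) (v.adicCompletion ℚ)) δ • Θ m i)
  (a : ↥(padicCoeffIntegers S)) (k : ℕ) (Nk : Fin r → Fin r → ℕ)

-- the coercion towers `H¹(Γ_n, T_ρ) → H¹(Γ_n, A_ρ[2^k])` between the cohomology dialects exceed the default budget (as in `…LayerPairingScalar`)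
set_option maxHeartbeats 1600000 in
/-- **(δ) Σ_bal — `⟨a • y, Q⟩_{n,2^k} = ⟨y, N_kᵀ Q⟩_{n,2^k}` for the residues `rhoLayerPairingPk`**, for every self-dual datum `e_k` balanced for
`a·` (`hc`, at the one-pair pins `OnePairPins.ePk_cofreeTorsionScalar_comm`) and every transport `Θ` whose conjugate of `a·` is the integer matrix
`N_k` on `E[2^k]^r` (`hN`, at the pins §3). GLUE, proved: `rhoLayerPairingPk_apply`, `reduceH1CofreePkTorsion_smul` (w2 g20),
`layerPairingOf_map_adjoint` (w2 g20), (γ). This is exactly the `hbal` binder of k3-g19 `hPA_of_levelwise` at level `k`.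
[cite: Kato2004Asterisque, §13.8 (pp. 228–229)] [cite: Kobayashi2003, (8.23) (p. 18)] [cite: PerrinRiou1994Invent, §3.6.1] -/
theorem rhoLayerPairingPk_smul_balance
    (hc : ∀ s t, ePk k ((cofreeTorsionScalar S ρ ((2 ^ k : ℕ) : ℤ) a).hom s) t = ePk k s ((cofreeTorsionLocalScalar S ρ ((2 ^ k : ℕ) : ℤ) a v).hom t))
    (hN : ∀ (P : Fin r → ↥(geomTorsion W ((2 ^ k : ℕ) : ℤ))) (j : Fin r),
      Θ (a • Θ.symm (fun i ↦ AddSubgroup.inclusion (geomTorsion_natCast_pow_le_geomPrimaryTorsion 2 k W) (P i))) j =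
        ∑ i, Nk i j • AddSubgroup.inclusion (geomTorsion_natCast_pow_le_geomPrimaryTorsion 2 k W) (P i))
    (n : ℕ) (y : H1 (FramedGaloisRep.toGaloisRep ρ) (κ.layerSubgroup n))
    (Q : Fin r → ↥(localLayerPointsOfEmb κ (closureEmb (K := ℚ) (v.adicCompletion ℚ)) W n)) :
    rhoLayerPairingPk S ρ W ePk hμPk hadd₁Pk hadd₂Pk hgalPk Θ κ v hΘ n k (a • y) Q =
      rhoLayerPairingPk S ρ W ePk hμPk hadd₁Pk hadd₂Pk hgalPk Θ κ v hΘ n k y (fun j ↦ ∑ i, Nk i j • Q i) := by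
  -- `rhoLayerPairingPk` is `layerPairingOf ∘ red_{2^k}` paired with `thetaLayerKummer` (definitional; the ascription fixes the cohomology dialect)
  have e1 : ∀ (x : H1 (FramedGaloisRep.toGaloisRep ρ) (κ.layerSubgroup n))
      (Q' : Fin r → ↥(localLayerPointsOfEmb κ (closureEmb (K := ℚ) (v.adicCompletion ℚ)) W n)),
      rhoLayerPairingPk S ρ W ePk hμPk hadd₁Pk hadd₂Pk hgalPk Θ κ v hΘ n k x Q' =
        layerPairingOf (cofreeTorsionGaloisModule S ρ ((2 ^ k : ℕ) : ℤ)) (2 ^ k) (ePk k) (hμPk k) (hadd₁Pk k) (hadd₂Pk k) (hgalPk k) κ v n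
          (reduceH1CofreePkTorsion S ρ k (κ.layerSubgroup n) x :
            H1 (cofreeTorsionGaloisModule S ρ ((2 ^ k : ℕ) : ℤ)) (κ.layerSubgroup n))
          (thetaLayerKummer S ρ k W Θ κ v hΘ n Q') := fun _ _ ↦ rfl
  rw [e1, e1, reduceH1CofreePkTorsion_smul,
    layerPairingOf_map_adjoint (cofreeTorsionGaloisModule S ρ ((2 ^ k : ℕ) : ℤ)) (2 ^ k) (ePk k) (hμPk k) (hadd₁Pk k) (hadd₂Pk k) (hgalPk k) κ v
      (cofreeTorsionScalar S ρ ((2 ^ k : ℕ) : ℤ) a) (cofreeTorsionLocalScalar S ρ ((2 ^ k : ℕ) : ℤ) a v) hc n,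
    cohomologyMap_cofreeTorsionLocalScalar_thetaLayerKummer S ρ k W Θ κ v hΘ a Nk
      (thetaSingle_cofreeTorsionLocalScalar_of_matrix S ρ k W Θ v a Nk hN) n Q]

end Glue

/-! ## §3 (ε) The matrix clause at the pins: integral Schur at `2` (Serre discharged), and Σ_bal for every one-pair pin bundle -/

section Pins

variable (W : WeierstrassCurve ℚ) [W.IsElliptic] [W.IsGloballyMinimal]

/-- **The conjugate of `a·` by a local transport datum is an integer matrix on every finite layer.** For `W` on the habitat (`GoodSS W 2`,
`a₂(W) = 0`), `v ∣ 2`, a `D_v`-equivariant `Θ : A_ρ ≃+ E[2^∞]^r` and `a ∈ 𝒪`: `Θ(a • Θ⁻¹ P)_j = Σ_i N i j • P_i` on `E[2^k]^r` for some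
`N ∈ ℕ^{r×r}` — INTEGRAL SCHUR (`decomp_equivariant_addMonoidHom_pi_primary_eq_sum_nsmul`) applied to `Φ_a := Θ ∘ (a·) ∘ Θ⁻¹`, which is
`D_v`-equivariant because `Γ_ℚ` acts `𝒪`-linearly on `A_ρ`; Serre 1972 Prop. 12 is the tree's theorem
`serre1972_supersingular_decompositionSubgroup_image_holds`. [cite: SerreInventiones1972, §1.11 Prop. 12, §2.2] [cite: Greenberg1989, §1 p. 98] -/
theorem exists_matrix_theta_smul (hss : GoodSS W 2) (ha2 : W.frobeniusTrace 2 = 0)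
    {S : Set (PadicAlgCl 2)} {d : ℕ} (ρ : FramedGaloisRep ℚ ↥(padicCoeffIntegers S) d) {r : ℕ}
    (v : HeightOneSpectrum (𝓞 ℚ)) (hv : ((2 : ℕ) : 𝓞 ℚ) ∈ v.asIdeal)
    (Θ : Cofree ρ ↥(padicCoeffField S) ≃+ (Fin r → ↥(W.geomPrimaryTorsion 2)))
    (hΘ : ∀ (δ : absoluteGaloisGroup (v.adicCompletion ℚ)) (m : Cofree ρ ↥(padicCoeffField S)) (i : Fin r),
      Θ (resGalOfEmb (closureEmb (K := ℚ) (v.adicCompletion ℚ)) δ • m) i =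
        resGalOfEmb (closureEmb (K := ℚ) (v.adicCompletion ℚ)) δ • Θ m i)
    (a : ↥(padicCoeffIntegers S)) (k : ℕ) :
    ∃ Nk : Fin r → Fin r → ℕ, ∀ (P : Fin r → ↥(geomTorsion W ((2 ^ k : ℕ) : ℤ))) (j : Fin r),
      Θ (a • Θ.symm (fun i ↦ AddSubgroup.inclusion (geomTorsion_natCast_pow_le_geomPrimaryTorsion 2 k W) (P i))) j =
        ∑ i, Nk i j • AddSubgroup.inclusion (geomTorsion_natCast_pow_le_geomPrimaryTorsion 2 k W) (P i) := by
  -- `Φ_a := Θ ∘ (a·) ∘ Θ⁻¹`, additive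
  obtain ⟨Φ, hΦ⟩ : ∃ Φ : (Fin r → ↥(W.geomPrimaryTorsion 2)) →+ (Fin r → ↥(W.geomPrimaryTorsion 2)), ∀ x, Φ x = Θ (a • Θ.symm x) :=
    ⟨AddMonoidHom.mk' (fun x ↦ Θ (a • Θ.symm x)) fun x y ↦ by rw [map_add, smul_add, map_add], fun _ ↦ rfl⟩
  -- `D_v`-equivariance of `Φ_a`
  have hΘsymm : ∀ (δ : absoluteGaloisGroup (v.adicCompletion ℚ)) (x : Fin r → ↥(W.geomPrimaryTorsion 2)),
      Θ.symm (resGalOfEmb (closureEmb (K := ℚ) (v.adicCompletion ℚ)) δ • x) =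
        resGalOfEmb (closureEmb (K := ℚ) (v.adicCompletion ℚ)) δ • Θ.symm x := fun δ x ↦ by
    apply Θ.injective
    rw [AddEquiv.apply_symm_apply]
    funext i
    rw [hΘ, AddEquiv.apply_symm_apply, Pi.smul_apply]
  have hΦsmul : ∀ (δ : absoluteGaloisGroup (v.adicCompletion ℚ)) (x : Fin r → ↥(W.geomPrimaryTorsion 2)) (i : Fin r),
      Φ (resGalOfEmb (closureEmb (K := ℚ) (v.adicCompletion ℚ)) δ • x) i =
        resGalOfEmb (closureEmb (K := ℚ) (v.adicCompletion ℚ)) δ • Φ x i := fun δ x i ↦ by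
    rw [hΦ, hΦ, hΘsymm, ← smul_comm (resGalOfEmb (closureEmb (K := ℚ) (v.adicCompletion ℚ)) δ) a (Θ.symm x), hΘ]
  obtain ⟨C, hC⟩ := decomp_equivariant_addMonoidHom_pi_primary_eq_sum_nsmul W serre1972_supersingular_decompositionSubgroup_image_holds
    hss ha2 v hv k Φ hΦsmul
  refine ⟨fun i j ↦ C j i, fun P j ↦ ?_⟩
  have htor : 2 ^ k • (fun i ↦ AddSubgroup.inclusion (geomTorsion_natCast_pow_le_geomPrimaryTorsion 2 k W) (P i)) = 0 := by
    funext i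
    rw [Pi.smul_apply, Pi.zero_apply, ← map_nsmul, ← natCast_zsmul,
      show ((2 ^ k : ℕ) : ℤ) • P i = 0 from Subtype.ext (zsmul_coe_geomTorsion_pow W k (P i)), map_zero]
  rw [← hΦ, hC _ htor j]

omit [W.IsGloballyMinimal] in
/-- **A point of `W[2^∞]` of exact order `2^(k+1)`**: a non-zero `2`-torsion point, then successive halving in the `2`-divisible group
`W[2^∞]` (`exists_two_nsmul_eq_primary`). [cite: SilvermanAEC2009, Cor. III.6.4(b), §VIII.2] -/
theorem exists_geomPrimaryTorsion_addOrderOf_eq_two_pow_succ (k : ℕ) :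
    ∃ P : ↥(W.geomPrimaryTorsion 2), addOrderOf P = 2 ^ (k + 1) := by
  induction k with
  | zero =>
    obtain ⟨Q, hQ⟩ := W.exists_ne_zero_geomTorsion_prime Nat.prime_two
    have hQ2 : 2 • (Q : geomPoints W) = 0 := AddSubgroup.torsionBy.nsmul_iff.1 Q.2
    refine ⟨⟨(Q : geomPoints W), AddCommGroup.mem_primaryComponent.2 ⟨1, by rw [pow_one]; exact hQ2⟩⟩, ?_⟩
    refine (addOrderOf_eq_prime (Subtype.ext ?_) fun h ↦ hQ (Subtype.ext ?_)).trans (pow_one 2).symm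
    · rw [AddSubmonoidClass.coe_nsmul, ZeroMemClass.coe_zero]; exact hQ2
    · rw [ZeroMemClass.coe_zero]; exact congrArg Subtype.val h
  | succ k ih =>
    obtain ⟨P, hP⟩ := ih
    obtain ⟨Q, hQ⟩ := exists_two_nsmul_eq_primary W P
    have h1 : 2 ^ (k + 1 + 1) • Q = 0 := by
      rw [pow_succ, mul_smul, hQ, ← hP]; exact addOrderOf_nsmul_eq_zero P
    have h2 : 2 ^ (k + 1) • Q ≠ 0 := by
      rw [pow_succ, mul_smul, hQ]
      exact nsmul_ne_zero_of_lt_addOrderOf (pow_ne_zero k two_ne_zero) (by rw [hP]; exact Nat.pow_lt_pow_right (by norm_num) k.lt_succ_self)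
    obtain ⟨j, hj, hQj⟩ := (Nat.dvd_prime_pow Nat.prime_two).1 (addOrderOf_dvd_of_nsmul_eq_zero h1)
    refine ⟨Q, ?_⟩
    rcases hj.lt_or_eq with hlt | heq
    · exact absurd (addOrderOf_dvd_iff_nsmul_eq_zero.1 (by rw [hQj]; exact pow_dvd_pow 2 (by omega))) h2
    · rw [hQj, heq]

omit [W.IsGloballyMinimal] in
/-- A point of `W[2^∞]` of exact order `2^k`. [cite: SilvermanAEC2009, Cor. III.6.4(b)] -/
theorem exists_geomPrimaryTorsion_addOrderOf_eq (k : ℕ) : ∃ P : ↥(W.geomPrimaryTorsion 2), addOrderOf P = 2 ^ k := by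
  cases k with
  | zero => exact ⟨0, by rw [pow_zero, addOrderOf_zero]⟩
  | succ k => exact exists_geomPrimaryTorsion_addOrderOf_eq_two_pow_succ W k

variable {S : Set (PadicAlgCl 2)} {d : ℕ} {ρ : FramedGaloisRep ℚ ↥(padicCoeffIntegers S) d} {r : ℕ}

omit [W.IsGloballyMinimal] in
/-- **The matrix clause determines `N` modulo `2^k`** (test it on a point of exact order `2^k` placed in one coordinate). [folklore]
[cite: SilvermanAEC2009, Cor. III.6.4(b)] -/
theorem matrix_theta_smul_unique_mod (Θ : Cofree ρ ↥(padicCoeffField S) ≃+ (Fin r → ↥(W.geomPrimaryTorsion 2)))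
    (a : ↥(padicCoeffIntegers S)) (k : ℕ) {N N' : Fin r → Fin r → ℕ}
    (hN : ∀ (P : Fin r → ↥(geomTorsion W ((2 ^ k : ℕ) : ℤ))) (j : Fin r),
      Θ (a • Θ.symm (fun i ↦ AddSubgroup.inclusion (geomTorsion_natCast_pow_le_geomPrimaryTorsion 2 k W) (P i))) j =
        ∑ i, N i j • AddSubgroup.inclusion (geomTorsion_natCast_pow_le_geomPrimaryTorsion 2 k W) (P i))
    (hN' : ∀ (P : Fin r → ↥(geomTorsion W ((2 ^ k : ℕ) : ℤ))) (j : Fin r),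
      Θ (a • Θ.symm (fun i ↦ AddSubgroup.inclusion (geomTorsion_natCast_pow_le_geomPrimaryTorsion 2 k W) (P i))) j =
        ∑ i, N' i j • AddSubgroup.inclusion (geomTorsion_natCast_pow_le_geomPrimaryTorsion 2 k W) (P i))
    (i j : Fin r) : ((2 ^ k : ℕ) : ℤ) ∣ (N i j : ℤ) - (N' i j : ℤ) := by
  obtain ⟨P, hP⟩ := exists_geomPrimaryTorsion_addOrderOf_eq W k
  have hPk : (2 ^ k) • (P : geomPoints W) = 0 := by
    rw [← AddSubmonoidClass.coe_nsmul, ← hP, addOrderOf_nsmul_eq_zero, ZeroMemClass.coe_zero]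
  obtain ⟨P', hincl⟩ : ∃ P' : ↥(geomTorsion W ((2 ^ k : ℕ) : ℤ)),
      AddSubgroup.inclusion (geomTorsion_natCast_pow_le_geomPrimaryTorsion 2 k W) P' = P :=
    ⟨⟨(P : geomPoints W), AddSubgroup.torsionBy.nsmul_iff.2 hPk⟩, Subtype.ext rfl⟩
  have key : ∀ M : Fin r → Fin r → ℕ,
      (∀ (P : Fin r → ↥(geomTorsion W ((2 ^ k : ℕ) : ℤ))) (j : Fin r),
        Θ (a • Θ.symm (fun i ↦ AddSubgroup.inclusion (geomTorsion_natCast_pow_le_geomPrimaryTorsion 2 k W) (P i))) j =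
          ∑ i, M i j • AddSubgroup.inclusion (geomTorsion_natCast_pow_le_geomPrimaryTorsion 2 k W) (P i)) →
      Θ (a • Θ.symm (fun l ↦ AddSubgroup.inclusion (geomTorsion_natCast_pow_le_geomPrimaryTorsion 2 k W)
        ((Pi.single i P' : Fin r → ↥(geomTorsion W ((2 ^ k : ℕ) : ℤ))) l))) j = M i j • P := fun M hM ↦ by
    rw [hM (Pi.single i P') j, Finset.sum_eq_single i (fun l _ hl ↦ by rw [Pi.single_eq_of_ne hl, map_zero, smul_zero])
      (fun h ↦ (h (Finset.mem_univ i)).elim), Pi.single_eq_same, hincl]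
  rw [← hP, addOrderOf_dvd_iff_zsmul_eq_zero, sub_zsmul, ← sub_eq_add_neg, sub_eq_zero, natCast_zsmul, natCast_zsmul,
    ← key N hN, ← key N' hN']

omit [W.IsElliptic] [W.IsGloballyMinimal] in
/-- The level-`(k+1)` matrix clause restricts to the level-`k` clause (`E[2^k] ⊂ E[2^(k+1)]`). [folklore] -/
theorem matrix_theta_smul_restrict (Θ : Cofree ρ ↥(padicCoeffField S) ≃+ (Fin r → ↥(W.geomPrimaryTorsion 2)))
    (a : ↥(padicCoeffIntegers S)) (k : ℕ) {N : Fin r → Fin r → ℕ}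
    (hN : ∀ (P : Fin r → ↥(geomTorsion W ((2 ^ (k + 1) : ℕ) : ℤ))) (j : Fin r),
      Θ (a • Θ.symm (fun i ↦ AddSubgroup.inclusion (geomTorsion_natCast_pow_le_geomPrimaryTorsion 2 (k + 1) W) (P i))) j =
        ∑ i, N i j • AddSubgroup.inclusion (geomTorsion_natCast_pow_le_geomPrimaryTorsion 2 (k + 1) W) (P i))
    (P : Fin r → ↥(geomTorsion W ((2 ^ k : ℕ) : ℤ))) (j : Fin r) :
    Θ (a • Θ.symm (fun i ↦ AddSubgroup.inclusion (geomTorsion_natCast_pow_le_geomPrimaryTorsion 2 k W) (P i))) j =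
      ∑ i, N i j • AddSubgroup.inclusion (geomTorsion_natCast_pow_le_geomPrimaryTorsion 2 k W) (P i) := by
  have hle : geomTorsion W ((2 ^ k : ℕ) : ℤ) ≤ geomTorsion W ((2 ^ (k + 1) : ℕ) : ℤ) :=
    W.geomTorsion_le_of_dvd (Int.natCast_dvd_natCast.2 (pow_dvd_pow 2 k.le_succ))
  have hcoe : (fun l ↦ AddSubgroup.inclusion (geomTorsion_natCast_pow_le_geomPrimaryTorsion 2 k W) (P l)) =
      fun l ↦ AddSubgroup.inclusion (geomTorsion_natCast_pow_le_geomPrimaryTorsion 2 (k + 1) W) (AddSubgroup.inclusion hle (P l)) :=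
    funext fun l ↦ Subtype.ext rfl
  rw [hcoe, hN]
  exact Finset.sum_congr rfl fun l _ ↦ rfl

/-- **`2`-adic packaging**: the level matrices of `Θ ∘ (a·) ∘ Θ⁻¹` can be chosen as the residues of ONE matrix `N ∈ M_r(ℤ₂)` —
`N_k ≡ N (mod 2^k)` entrywise (compatibility from `matrix_theta_smul_unique_mod` + `matrix_theta_smul_restrict`, limit by
`PadicInt.ofIntSeq`). This is exactly the pair of binders `(hNk, hbal)` of k3-g19 `hPA_of_levelwise` / the matrix of k4-g20 `H9locValues`.
[cite: SerreInventiones1972, §1.11 Prop. 12, §2.2] [cite: Greenberg1989, §1 p. 98] -/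
theorem exists_padicInt_matrix_theta_smul (hss : GoodSS W 2) (ha2 : W.frobeniusTrace 2 = 0) (ρ : FramedGaloisRep ℚ ↥(padicCoeffIntegers S) d)
    (v : HeightOneSpectrum (𝓞 ℚ)) (hv : ((2 : ℕ) : 𝓞 ℚ) ∈ v.asIdeal)
    (Θ : Cofree ρ ↥(padicCoeffField S) ≃+ (Fin r → ↥(W.geomPrimaryTorsion 2)))
    (hΘ : ∀ (δ : absoluteGaloisGroup (v.adicCompletion ℚ)) (m : Cofree ρ ↥(padicCoeffField S)) (i : Fin r),
      Θ (resGalOfEmb (closureEmb (K := ℚ) (v.adicCompletion ℚ)) δ • m) i =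
        resGalOfEmb (closureEmb (K := ℚ) (v.adicCompletion ℚ)) δ • Θ m i)
    (a : ↥(padicCoeffIntegers S)) :
    ∃ (N : Fin r → Fin r → ℤ_[2]) (Nk : ℕ → Fin r → Fin r → ℕ),
      (∀ (k : ℕ) (i j : Fin r), ((Nk k i j : ℕ) : ZMod (2 ^ k)) = PadicInt.toZModPow k (N i j)) ∧
      ∀ (k : ℕ) (P : Fin r → ↥(geomTorsion W ((2 ^ k : ℕ) : ℤ))) (j : Fin r),
        Θ (a • Θ.symm (fun i ↦ AddSubgroup.inclusion (geomTorsion_natCast_pow_le_geomPrimaryTorsion 2 k W) (P i))) j =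
          ∑ i, Nk k i j • AddSubgroup.inclusion (geomTorsion_natCast_pow_le_geomPrimaryTorsion 2 k W) (P i) := by
  choose Nk hNk using fun k ↦ exists_matrix_theta_smul W hss ha2 ρ v hv Θ hΘ a k
  have hdvd : ∀ (i j : Fin r) (k : ℕ), ((2 : ℕ) : ℤ) ^ k ∣ (Nk (k + 1) i j : ℤ) - (Nk k i j : ℤ) := fun i j k ↦ by
    rw [← Nat.cast_pow]
    exact matrix_theta_smul_unique_mod W Θ a k (matrix_theta_smul_restrict W Θ a k (hNk (k + 1))) (hNk k) i j
  refine ⟨fun i j ↦ PadicInt.ofIntSeq _ (PadicInt.isCauSeq_padicNorm_of_pow_dvd_sub (fun k ↦ (Nk k i j : ℤ)) 2 (hdvd i j)), Nk,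
    fun k i j ↦ ?_, hNk⟩
  show ((Nk k i j : ℕ) : ZMod (2 ^ k)) =
    PadicInt.toZModPow k (PadicInt.ofIntSeq _ (PadicInt.isCauSeq_padicNorm_of_pow_dvd_sub (fun k ↦ (Nk k i j : ℤ)) 2 (hdvd i j)))
  rw [PadicInt.toZModPow_ofIntSeq_of_pow_dvd_sub (fun k ↦ (Nk k i j : ℤ)) 2 (hdvd i j) k, Int.cast_natCast]

end Pins

/-! ## §4 Σ_bal for every one-pair pin bundle `π` — levelwise AND `2`-adically packaged (k3-g19 `hPA_of_levelwise` binders `hNk`, `hbal`) -/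

section OnePair

variable {S : Set (PadicAlgCl 2)} (W : WeierstrassCurve ℚ) [W.IsElliptic] [W.IsGloballyMinimal] {κ : ZpExtension ℚ 2}
  {γ : absoluteGaloisGroup ℚ} {S₀ : Finset (HeightOneSpectrum (𝓞 ℚ))} {n : ℕ} {ρ : FramedGaloisRep ℚ ↥(padicCoeffIntegers S) 2}
  {Θ : ∀ v : HeightOneSpectrum (𝓞 ℚ), ((2 : ℕ) : 𝓞 ℚ) ∈ v.asIdeal → (Cofree ρ ↥(padicCoeffField S) ≃+ (Fin n → ↥(W.geomPrimaryTorsion 2)))}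
  {hΘ : ∀ v hv (δ : absoluteGaloisGroup (v.adicCompletion ℚ)) m i,
    Θ v hv (resGalOfEmb (closureEmb (K := ℚ) (v.adicCompletion ℚ)) δ • m) i = resGalOfEmb (closureEmb (K := ℚ) (v.adicCompletion ℚ)) δ • Θ v hv m i}
  {I : Kato2004.IwasawaH1DataCoeff (FramedGaloisRep.toGaloisRep ρ) 2 κ γ}
  {Sg : AddSubgroup (subgroupH1 κ.kerSubgroup (Cofree ρ ↥(padicCoeffField S)))} [Module ↥(padicCoeffIntegers S) ↥Sg]
  (π : OnePairPins S W κ γ S₀ n ρ Θ hΘ I Sg)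

/-- **Σ_bal for every one-pair pin bundle `π`, `2`-adically packaged** (habitat `GoodSS W 2`, `a₂ = 0`): for `a ∈ 𝒪` there are ONE matrix
`N ∈ M_n(ℤ₂)` and level representatives `N_k ∈ ℕ^{n×n}`, `N_k ≡ N (mod 2^k)`, with `⟨a • y, Q⟩_{m,2^k} = ⟨y, N_kᵀ Q⟩_{m,2^k}` for ALL layers
`m`, levels `k`, classes `y ∈ H¹(Γ_m, T_ρ)` and tuples `Q ∈ E(ℚ_{m,v})ⁿ` — (δ) with `hc := π.ePk_cofreeTorsionScalar_comm` and `hN` from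
`exists_padicInt_matrix_theta_smul`. These are VERBATIM the binders `N`, `Nk`, `hNk`, `hbal` of k3-g19 `SideaK3G19.hPA_of_levelwise`.
[cite: Kato2004Asterisque, §13.8 (pp. 228–229)] [cite: Kobayashi2003, (8.23) (p. 18)] [cite: SerreInventiones1972, §1.11 Prop. 12] -/
theorem rhoLayerPairingPk_smul_balance_pins (hss : GoodSS W 2) (ha2 : W.frobeniusTrace 2 = 0) (a : ↥(padicCoeffIntegers S)) :
    ∃ (N : Fin n → Fin n → ℤ_[2]) (Nk : ℕ → Fin n → Fin n → ℕ),
      (∀ (k : ℕ) (i j : Fin n), ((Nk k i j : ℕ) : ZMod (2 ^ k)) = PadicInt.toZModPow k (N i j)) ∧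
      ∀ (m k : ℕ) (y : H1 (FramedGaloisRep.toGaloisRep ρ) (κ.layerSubgroup m))
        (Q : Fin n → ↥(localLayerPointsOfEmb κ (closureEmb (K := ℚ) (π.v.adicCompletion ℚ)) W m)),
        rhoLayerPairingPk S ρ W π.ePk π.hμPk π.hadd₁Pk π.hadd₂Pk π.hgalPk (Θ π.v π.hv) κ π.v (hΘ π.v π.hv) m k (a • y) Q =
          rhoLayerPairingPk S ρ W π.ePk π.hμPk π.hadd₁Pk π.hadd₂Pk π.hgalPk (Θ π.v π.hv) κ π.v (hΘ π.v π.hv) m k y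
            (fun j ↦ ∑ i, Nk k i j • Q i) := by
  obtain ⟨N, Nk, hNk, hN⟩ := exists_padicInt_matrix_theta_smul W hss ha2 ρ π.v π.hv (Θ π.v π.hv) (hΘ π.v π.hv) a
  exact ⟨N, Nk, hNk, fun m k y Q ↦ rhoLayerPairingPk_smul_balance S ρ W π.ePk π.hμPk π.hadd₁Pk π.hadd₂Pk π.hgalPk (Θ π.v π.hv) κ π.v
    (hΘ π.v π.hv) a k (Nk k) (fun s t ↦ π.ePk_cofreeTorsionScalar_comm k a s t) (hN k) m y Q⟩

/-- **Σ_bal on THE pairing `π.pair`, residue form**: with `N`, `N_k` as above, `⟨a • y, Q⟩_m ≡ ⟨y, N_kᵀ Q⟩_m (mod 2^k)` in `ℤ₂` for every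
`k` (`π.hpair`). Feeding k3-g19 `hPA_of_levelwise` then yields the exact identity `⟨a • y, Q⟩_m = Σ_i Σ_l N i l · ⟨y, Q_l δ_i⟩_m` in `ℤ₂`
(its theorem, not restated here). [cite: Kato2004Asterisque, §13.8 (pp. 228–229)] [cite: Kobayashi2003, (8.23) (p. 18)] -/
theorem toZModPow_pair_smul (hss : GoodSS W 2) (ha2 : W.frobeniusTrace 2 = 0) (a : ↥(padicCoeffIntegers S)) :
    ∃ (N : Fin n → Fin n → ℤ_[2]) (Nk : ℕ → Fin n → Fin n → ℕ),
      (∀ (k : ℕ) (i j : Fin n), ((Nk k i j : ℕ) : ZMod (2 ^ k)) = PadicInt.toZModPow k (N i j)) ∧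
      ∀ (m k : ℕ) (y : H1 (FramedGaloisRep.toGaloisRep ρ) (κ.layerSubgroup m))
        (Q : Fin n → ↥(localLayerPointsOfEmb κ (closureEmb (K := ℚ) (π.v.adicCompletion ℚ)) W m)),
        PadicInt.toZModPow k (π.pair m (a • y) Q) = PadicInt.toZModPow k (π.pair m y (fun j ↦ ∑ i, Nk k i j • Q i)) := by
  obtain ⟨N, Nk, hNk, hbal⟩ := rhoLayerPairingPk_smul_balance_pins W π hss ha2 a
  exact ⟨N, Nk, hNk, fun m k y Q ↦ by rw [π.hpair, π.hpair, hbal]⟩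

end OnePair



end Summit.BirchSwinnertonDyer.BirchSwinnertonDyer.Cruxes.ResidualThetaCountLowerPureAtTwo.SideaK3G20

end
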